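/-
Copyright (c) 2026 the pub-hodgecm-mathlib formalisation cell (harness21).  Prover seat hodgecm-mathlib-K2E4-p10 (g11), Track B «K2-LIT»,
#184♮ = hLiu418 = `stmt-HodgeConjecture-24832`; socket #41, KIND 1 — (K1a-T)(L2-dock)(ρ) THE ARCH LOCAL READING OF RECORD, `g`-LEVEL (K1a desk K2Liu-p01 (g11)
WORD #20 (4), RE-KEYED by WORD #22 (2), 2026-09-05T03:32:15Z): the POINTWISE identity between the (o1)-face's place-pure local integrand of record
(★ p864502 `Ψloc` ∕ ★ p864726 `blockD_arch_of_record`) and the (α) arch-alphabet producer's sign-split twisted scalar-type integrand (★ p865046 ∕ ED.3 `_g`),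
and ★ p864726's agreement letter `hA₀` from ED.3's `g`-level agreements.
THEOREMS ONLY (no `def`, no `instance`, no notation, no named-fact hypothesis, no `sorry`).
-/
import Summits.HodgeConjecture.HodgeConjecture.Theorems.K2LiuKindOneSingularCornerIndexDatum   -- ★ p864832 (LH4-p17): `framedIndex_single_of_shimuraFrame`, `exists_cornerDatum_at_place`, sign algebra
import Summits.HodgeConjecture.HodgeConjecture.Theorems.K2LiuArchInducedTubeDefs              -- ★ `hermOfReal`, `archScalarSection`
import Mathlib.MeasureTheory.Integral.Bochner.Basic
import HarnessLib

/-!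
# Crux `HLiu418`, socket #41, KIND 1 a♮ — (K1a-T)(L2-dock)(ρ) `K2LiuKindOneSingularArchLocalReadingOfRecord`: THE RECORD'S LOCAL INTEGRAND READ AS (α)'s TWISTED SCALAR TYPE

Cell `hodgecm-mathlib`, crux item hLiu418 = `stmt-HodgeConjecture-24832` (helper lane `--supports … --as helper`, count-neutral), route of record `HCCMUnconditional`;
squad K2 ∕ K2Liu, road `K2_Liu`, socket #41, KIND 1, block K1-a♮.  CONSUMER: the K1-a♮ ∕ D-1 tie (typ4 v30∕v31): `have hA₀ := hA₀_of_hA₀' … hA₀p' hA₀n'` turns (α) ED.3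
`archLetters_of_scalarTypeGrowth_g`'s (C2) into ★ p864726 `K2LiuIncoherentRankOneBlockDArchOfRecord.blockD_arch_of_record`'s `hA₀` :121–:128.

THE SETTING.  At the (o1) face of record (★ p864502 → ★ p864260 → ★ p864594, arch column ★ p864726) the local block at the complex place `w` is the integral over
`r : Fin 2 → Fin 2 → ℝ` of the place-pure integrand `Ψloc X p w s (n(r)·g) = [w = w₀ ? γ X p s : 1] · eb X w (blk n(r)) · Fs X p w s (Frx X w · n(r) · g)`, `g` the frame of the
translate — all BY VALUE here with their READING letters (= the tie's lambdas, typ4 v29 :685–:819): `blk m = m₁₂`, `n(r) = nfr w r = (1 H(r); 0 1)` (`H(r) = hermOfReal r`),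
`Frx X w = J` (the Weyl element's frame), `Fs X p w s = archScalarSection (k p w) s` (scalar `K_∞`-type `k p w`), and (E) ★ p863743's character
`eb X w b = e(−tr(hidx·b))` with the framed corner index `hidx = −2·(T_w)₂₂·ι_w(single 1 1 (σc X))·(T_w⁻¹)₁₁` in CLOSED FORM (:758–:759).  THE POINT (★ p864832): in the Shimura frame
`hidx = single 1 1 (i·sgn t₁·ι_w σc X)` and, `σc X` being skew (`c σc = −σc`, so `ι_w σc X ∈ iℝ`), this is `± a·hermTwo(w(σc X), 0, 0)·aᴴ` for ANY frame `a` with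
`a·hermTwo(y,0,0)·aᴴ = single 1 1 y` (`hay`, LH4-p17's `exists_frame_single_apply 1` — the SAME `a` as (α)'s), the sign being that of `−sgn(t₁)·Im ι_w σc X` (never `0` for `σc X ≠ 0`).
Hence, pointwise in `(g, r)` and with the scalar `sc X p w s = [w = w₀ ? γ : 1]` pulled out:
`Ψloc(n(r)·g) = sc · e(−tr(±a·hermTwo(tw X w,0,0)·aᴴ·H(r))) · archScalarSection (k p w) s (J·n(r)·g)` with `tw X w = w(σc X)` — the integrand of (α)'s sign-split readings.
* §1 `neg_single` (bookkeeping), **`framedCornerIndex_eq_of_pos ∕ _of_neg`** — the framed corner index for a GIVEN frame `a` with `hay` (★ p864832 §2 + the sign algebra);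
* §2 **`theta_eq_of_record`** — the POINTWISE, `g`-level integrand identity (both signs); **`hA₀_of_hA₀'`** — ★ p864726's `hA₀` from (α) ED.3's sign-split `g`-level agreements
  (`integral_congr_ae` + `∫ c·f = c·∫ f`);
* §3 **`hsc_of_record`**, **`hscb_of_record`** — (α) ED.3's letters `hsc hscb` for the tie's scalar `([w = w₀] ? c^{2(s−2)}·cj p : 1)·cF p w` (entire, X-free).
HONEST LABEL.  Count-neutral helper (rewriting along reading letters); every letter is discharged at the tie by `rfl` or a ★ name EXCEPT possibly `hFs` (the scalar-type reading of the
record's flat sections — a (T)-letter of the face, see the K2 bus note of this file); it closes no socket: `HC_CM` is proved only modulo the 7 printed citations (2 remaining named inputs: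
hLiu418 = `stmt-HodgeConjecture-24832`, h413 = `stmt-HodgeConjecture-24833`) until rung 0 closes.

## References
* [Shimura1997] G. Shimura, *Euler Products and Eisenstein Series*, CBMS 93 (1997): §18.1 (18.4), §18.4 (`ψ(tr(β n(b)))` place by place).
* [Shimura1982] G. Shimura, *Confluent hypergeometric functions on tube domains*, Math. Ann. 260 (1982): §4 Thm. 4.2.
* [KudlaRallis1994] S. Kudla, S. Rallis, *A regularized Siegel–Weil formula: the first term identity*, Ann. of Math. 140 (1994): §2 (2.10)–(2.12).
* [Tate1967] J. Tate, *Fourier analysis in number fields and Hecke's zeta-functions* (Cassels–Fröhlich 1967): §3 Thm. 3.3.1.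
-/

set_option autoImplicit false
-- the mandated namespace repeats the single-problem summit's segment (`HodgeConjecture.HodgeConjecture`)
set_option linter.dupNamespace false

noncomputable section

open scoped Matrix ComplexConjugate
open Complex Matrix NumberField NumberField.InfinitePlace IsDedekindDomain MeasureTheory
open Literature.NumberTheory.Automorphic Literature.NumberTheory.Automorphic.UnitaryGroup Literature.NumberTheory.GaloisRepresentations
open Literature.NumberTheory.GelbartRogawski1991 Literature.NumberTheory.GelbartRogawski1991.GRConstruction
open Literature.NumberTheory.GelbartRogawski1991.UnitaryDualPair

namespace Summit.HodgeConjecture.HodgeConjecture.Cruxes.HLiu418.K2LiuKindOneSingularArchLocalReadingOfRecord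

open K2LiuSiegelUnipotentFourierDefs
open K2LiuHermTwoGammaDefs (hermTwo)
open K2LiuArchInducedTubeDefs (hermOfReal archScalarSection)
open K2LiuIncoherentRankOneSignJunction (re_embedding_eq_zero_of_complexConj_eq_neg)
open K2LiuKindOneSingularCornerIndexDatum (framedIndex_single_of_shimuraFrame exists_cornerDatum_at_place norm_I_mul_sign_mul im_I_mul_ofReal_mul re_I_mul_ofReal_mul)

/-! ## §1 The framed corner index for a given coordinate frame -/

section Corner

/-- `−single i j c = single i j (−c)`. [folklore] -/
theorem neg_single {m : Type*} [DecidableEq m] (i j : m) (c : ℂ) : -Matrix.single i j c = Matrix.single i j (-c) := by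
  rw [← neg_one_smul ℂ (Matrix.single i j c), Matrix.smul_single, smul_eq_mul, neg_one_mul]

variable {L : Type} [Field L] [NumberField L] [IsCMField L]

/-- **THE FRAMED CORNER INDEX, POSITIVE SIGN, FOR A GIVEN FRAME `a`.**  In the Shimura frame `(T, T⁻¹)` of the datum `t` (★ `exists_tubeFrame_arch₄` (x) letters `hTdef hTinvdef`)
at a complex place `w`, for a skew corner value `σ` (`c σ = −σ`) with `0 < −sgn(t₁)·Im ι_w σ` and any frame `a` with `a·hermTwo(y,0,0)·aᴴ = single 1 1 y`:
`−2·T₂₂·ι_w(single 1 1 σ)·T⁻¹₁₁ = a·hermTwo(w(σ), 0, 0)·aᴴ`. [cite: Shimura1997, §18.1 (18.4)] [cite: Shimura1982, §4 Thm. 4.2] -/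
theorem framedCornerIndex_eq_of_pos (w : {w : InfinitePlace L // w.IsComplex}) (T Tinv : Matrix (Fin 2 ⊕ Fin 2) (Fin 2 ⊕ Fin 2) ℂ) (t : Fin 2 → ℝ) (ht : ∀ i, t i ≠ 0)
    (hTdef : T = fromBlocks (diagonal (fun i => (Real.sqrt (|t i| / 2) : ℂ))) (diagonal (fun i => (Real.sqrt (|t i| / 2) : ℂ)))
          (diagonal (fun i => I * (((t i / |t i|) * Real.sqrt (|t i| / 2) : ℝ) : ℂ))) (-diagonal (fun i => I * (((t i / |t i|) * Real.sqrt (|t i| / 2) : ℝ) : ℂ))))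
    (hTinvdef : Tinv = fromBlocks (diagonal (fun i => (((Real.sqrt (|t i| / 2))⁻¹ / 2 : ℝ) : ℂ))) (-diagonal (fun i => I * (((Real.sqrt (|t i| / 2))⁻¹ * (t i / |t i|) / 2 : ℝ) : ℂ)))
          (diagonal (fun i => (((Real.sqrt (|t i| / 2))⁻¹ / 2 : ℝ) : ℂ))) (diagonal (fun i => I * (((Real.sqrt (|t i| / 2))⁻¹ * (t i / |t i|) / 2 : ℝ) : ℂ))))
    (a : Matrix (Fin 2) (Fin 2) ℂ) (hay : ∀ y : ℝ, a * hermTwo (y, 0, 0) * aᴴ = Matrix.single 1 1 (y : ℂ))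
    {σ : L} (hσ : IsCMField.complexConj L σ = -σ) (hpos : 0 < -((t 1 / |t 1|) * (w.1.embedding σ).im)) :
    (-2 : ℂ) • (T.toBlocks₂₂ * (Matrix.single 1 1 σ).map w.1.embedding * Tinv.toBlocks₁₁) = a * hermTwo (w.1 σ, 0, 0) * aᴴ := by
  have hre := re_embedding_eq_zero_of_complexConj_eq_neg w.1.embedding hσ
  have hval : I * ((t 1 / |t 1| : ℝ) : ℂ) * w.1.embedding σ = ((-((t 1 / |t 1|) * (w.1.embedding σ).im) : ℝ) : ℂ) :=
    Complex.ext (by rw [re_I_mul_ofReal_mul, Complex.ofReal_re]) (by rw [im_I_mul_ofReal_mul, hre, mul_zero, Complex.ofReal_im])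
  have hnorm : w.1 σ = -((t 1 / |t 1|) * (w.1.embedding σ).im) := by
    rw [← InfinitePlace.norm_embedding_eq, ← norm_I_mul_sign_mul (ht 1) (w.1.embedding σ), hval, Complex.norm_real, Real.norm_eq_abs, abs_of_pos hpos]
  rw [Matrix.map_single, framedIndex_single_of_shimuraFrame T Tinv t ht hTdef hTinvdef 1 (w.1.embedding σ), hval, hay, hnorm]

/-- **THE FRAMED CORNER INDEX, NEGATIVE SIGN, FOR A GIVEN FRAME `a`**: with `−sgn(t₁)·Im ι_w σ < 0`, `−2·T₂₂·ι_w(single 1 1 σ)·T⁻¹₁₁ = −(a·hermTwo(w(σ), 0, 0)·aᴴ)`.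
[cite: Shimura1997, §18.1 (18.4)] [cite: Shimura1982, §4 Thm. 4.2] -/
theorem framedCornerIndex_eq_of_neg (w : {w : InfinitePlace L // w.IsComplex}) (T Tinv : Matrix (Fin 2 ⊕ Fin 2) (Fin 2 ⊕ Fin 2) ℂ) (t : Fin 2 → ℝ) (ht : ∀ i, t i ≠ 0)
    (hTdef : T = fromBlocks (diagonal (fun i => (Real.sqrt (|t i| / 2) : ℂ))) (diagonal (fun i => (Real.sqrt (|t i| / 2) : ℂ)))
          (diagonal (fun i => I * (((t i / |t i|) * Real.sqrt (|t i| / 2) : ℝ) : ℂ))) (-diagonal (fun i => I * (((t i / |t i|) * Real.sqrt (|t i| / 2) : ℝ) : ℂ))))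
    (hTinvdef : Tinv = fromBlocks (diagonal (fun i => (((Real.sqrt (|t i| / 2))⁻¹ / 2 : ℝ) : ℂ))) (-diagonal (fun i => I * (((Real.sqrt (|t i| / 2))⁻¹ * (t i / |t i|) / 2 : ℝ) : ℂ)))
          (diagonal (fun i => (((Real.sqrt (|t i| / 2))⁻¹ / 2 : ℝ) : ℂ))) (diagonal (fun i => I * (((Real.sqrt (|t i| / 2))⁻¹ * (t i / |t i|) / 2 : ℝ) : ℂ))))
    (a : Matrix (Fin 2) (Fin 2) ℂ) (hay : ∀ y : ℝ, a * hermTwo (y, 0, 0) * aᴴ = Matrix.single 1 1 (y : ℂ))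
    {σ : L} (hσ : IsCMField.complexConj L σ = -σ) (hneg : -((t 1 / |t 1|) * (w.1.embedding σ).im) < 0) :
    (-2 : ℂ) • (T.toBlocks₂₂ * (Matrix.single 1 1 σ).map w.1.embedding * Tinv.toBlocks₁₁) = -(a * hermTwo (w.1 σ, 0, 0) * aᴴ) := by
  have hre := re_embedding_eq_zero_of_complexConj_eq_neg w.1.embedding hσ
  have hval : I * ((t 1 / |t 1| : ℝ) : ℂ) * w.1.embedding σ = ((-((t 1 / |t 1|) * (w.1.embedding σ).im) : ℝ) : ℂ) :=
    Complex.ext (by rw [re_I_mul_ofReal_mul, Complex.ofReal_re]) (by rw [im_I_mul_ofReal_mul, hre, mul_zero, Complex.ofReal_im])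
  have hnorm : w.1 σ = -(-((t 1 / |t 1|) * (w.1.embedding σ).im)) := by
    rw [← InfinitePlace.norm_embedding_eq, ← norm_I_mul_sign_mul (ht 1) (w.1.embedding σ), hval, Complex.norm_real, Real.norm_eq_abs, abs_of_neg hneg]
  rw [Matrix.map_single, framedIndex_single_of_shimuraFrame T Tinv t ht hTdef hTinvdef 1 (w.1.embedding σ), hval, hay, hnorm, Complex.ofReal_neg, neg_single, neg_neg]

end Corner

/-! ## §2 The pointwise reading of record (`g`-level) and ★ p864726's `hA₀` from (α) ED.3's `hA₀p' hA₀n'` -/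

section Bridge

variable (L : Type) [Field L] [NumberField L] [IsCMField L]
variable {N M : ℕ} (e : Fin N × Fin M ≃ Fin 2) (dV : Fin N → L) (hdV : ∀ i, IsCMField.complexConj L (dV i) = dV i)
  (dW : Fin M → L) (hdW : ∀ i, IsCMField.complexConj L (dW i) = dW i)

/-- **(ρ) THE POINTWISE ARCH READING OF RECORD, BOTH SIGNS.**  INPUTS (BY VALUE, each READING letter = the record lambda of the tie, typ4 v29 :685–:819, so `rfl` there):
the places `Tinf`; the frame datum `t` (`ht`) with the Shimura frames `T Tinv` (`hTdef hTinvdef`, ★ `exists_tubeFrame_arch₄` (x) per place; the record's `t w k := Re ι_w(dV·dW)` docks by `β`);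
★ (A)'s corner scalar `σc` (`hσskew` skew, `hσ0` non-zero on rank-one indices); (E) the character `eb` with ★ p863743's framed corner index IN CLOSED FORM (`heb`); (T) the `K_∞`-types
`k` and flat sections `Fs` (`hFs`: scalar type — a GENUINE letter at the record, see the file's bus note), the distinguished place `w₀`, face scalar `γ` and pulled-out scalar `sc` (`hsc`);
(M) the frames `Frx` (`hFrx`: `= J`), `nfr` (`hnfr`), `blk` (`hblk`); (α)'s `tw` (`htw_eq`), `sgn` (`hsgnp hsgnn`) and frame `a` (`hay`).  OUTPUT, for every rank-one `X`, face `p`,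
`w ∈ Tinf`, `s`, `g`, `r`: the record's integrand `[w = w₀ ? γ : 1]·eb(blk n(r))·Fs(Frx·n(r)·g)` EQUALS `sc X p w s · (e(−tr(±a·hermTwo(tw X w,0,0)·aᴴ·H(r))) · archScalarSection (k p w) s (J·n(r)·g))`,
sign `+` on `sgn X w = true`, `−` on `sgn X w = false`. [cite: Shimura1997, §18.1 (18.4), §18.4] [cite: KudlaRallis1994, §2 (2.10)–(2.12)] [cite: Tate1967, §3 Thm. 3.3.1] -/
theorem theta_eq_of_record {φ : Type*} [DecidableEq {w : InfinitePlace L // w.IsComplex}] (Tinf : Finset (InfinitePlace L))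
    -- the frame datum and the Shimura frames of record, per complex place
    (t : {w : InfinitePlace L // w.IsComplex} → Fin 2 → ℝ) (ht : ∀ w i, t w i ≠ 0) (T Tinv : {w : InfinitePlace L // w.IsComplex} → Matrix (Fin 2 ⊕ Fin 2) (Fin 2 ⊕ Fin 2) ℂ)
    (hTdef : ∀ w, T w = fromBlocks (diagonal (fun i => (Real.sqrt (|t w i| / 2) : ℂ))) (diagonal (fun i => (Real.sqrt (|t w i| / 2) : ℂ)))
          (diagonal (fun i => Complex.I * (((t w i / |t w i|) * Real.sqrt (|t w i| / 2) : ℝ) : ℂ)))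
          (-diagonal (fun i => Complex.I * (((t w i / |t w i|) * Real.sqrt (|t w i| / 2) : ℝ) : ℂ))))
    (hTinvdef : ∀ w, Tinv w = fromBlocks (diagonal (fun i => (((Real.sqrt (|t w i| / 2))⁻¹ / 2 : ℝ) : ℂ)))
          (-diagonal (fun i => Complex.I * (((Real.sqrt (|t w i| / 2))⁻¹ * (t w i / |t w i|) / 2 : ℝ) : ℂ)))
          (diagonal (fun i => (((Real.sqrt (|t w i| / 2))⁻¹ / 2 : ℝ) : ℂ))) (diagonal (fun i => Complex.I * (((Real.sqrt (|t w i| / 2))⁻¹ * (t w i / |t w i|) / 2 : ℝ) : ℂ))))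
    -- ★ (A)'s corner scalar (skew, non-zero on rank-one indices)
    (σc : skewMatrices ((IsCMField.complexConj L : L ≃ₐ[Fp L] L) : L →+* L) ((gramR L e dV hdV dW hdW).map (algebraMap (Fp L) L)) → L)
    (hσskew : ∀ X : skewMatrices ((IsCMField.complexConj L : L ≃ₐ[Fp L] L) : L →+* L) ((gramR L e dV hdV dW hdW).map (algebraMap (Fp L) L)),
      (X : Matrix (Fin 2) (Fin 2) L) ≠ 0 → (X : Matrix (Fin 2) (Fin 2) L).det = 0 → IsCMField.complexConj L (σc X) = -σc X)
    (hσ0 : ∀ X : skewMatrices ((IsCMField.complexConj L : L ≃ₐ[Fp L] L) : L →+* L) ((gramR L e dV hdV dW hdW).map (algebraMap (Fp L) L)),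
      (X : Matrix (Fin 2) (Fin 2) L) ≠ 0 → (X : Matrix (Fin 2) (Fin 2) L).det = 0 → σc X ≠ 0)
    -- (E) the character of record: ★ p863743's `eb` with the framed corner index in closed form (typ4 v29 :758–:759)
    (eb : skewMatrices ((IsCMField.complexConj L : L ≃ₐ[Fp L] L) : L →+* L) ((gramR L e dV hdV dW hdW).map (algebraMap (Fp L) L)) → {w : InfinitePlace L // w.IsComplex} → Matrix (Fin 2) (Fin 2) ℂ → ℂ)
    (heb : ∀ (X : skewMatrices ((IsCMField.complexConj L : L ≃ₐ[Fp L] L) : L →+* L) ((gramR L e dV hdV dW hdW).map (algebraMap (Fp L) L))) (w : {w : InfinitePlace L // w.IsComplex}) (b : Matrix (Fin 2) (Fin 2) ℂ), eb X w b =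
      cexp (-(2 * Real.pi * Complex.I) * (((-2 : ℂ) • ((T w).toBlocks₂₂ * (Matrix.single (1 : Fin 2) (1 : Fin 2) (σc X)).map w.1.embedding * (Tinv w).toBlocks₁₁)) * b).trace))
    -- (T) the `K_∞`-types and the flat sections, the distinguished place with the face scalar, the pulled-out scalar
    (k : φ → {w : InfinitePlace L // w.IsComplex} → ℤ) (Fs : skewMatrices ((IsCMField.complexConj L : L ≃ₐ[Fp L] L) : L →+* L) ((gramR L e dV hdV dW hdW).map (algebraMap (Fp L) L)) → φ → {w : InfinitePlace L // w.IsComplex} → ℂ → Matrix (Fin 2 ⊕ Fin 2) (Fin 2 ⊕ Fin 2) ℂ → ℂ)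
    (cF : φ → {w : InfinitePlace L // w.IsComplex} → ℂ)
    (hFs : ∀ X p w s (m : Matrix (Fin 2 ⊕ Fin 2) (Fin 2 ⊕ Fin 2) ℂ), mᴴ * Matrix.J (Fin 2) ℂ * m = Matrix.J (Fin 2) ℂ → Fs X p w s m = cF p w * archScalarSection (k p w) s m)
    (w₀ : {w : InfinitePlace L // w.IsComplex}) (γ : skewMatrices ((IsCMField.complexConj L : L ≃ₐ[Fp L] L) : L →+* L) ((gramR L e dV hdV dW hdW).map (algebraMap (Fp L) L)) → φ → ℂ → ℂ) (sc : skewMatrices ((IsCMField.complexConj L : L ≃ₐ[Fp L] L) : L →+* L) ((gramR L e dV hdV dW hdW).map (algebraMap (Fp L) L)) → φ → InfinitePlace L → ℂ → ℂ)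
    (hsc : ∀ X p (w : InfinitePlace L) s, sc X p w s = (if (⟨w, IsTotallyComplex.isComplex w⟩ : {w : InfinitePlace L // w.IsComplex}) = w₀ then γ X p s else 1) * cF p ⟨w, IsTotallyComplex.isComplex w⟩)
    -- (M) the frame of the Weyl element, the unipotent variable and its block
    (Frx : skewMatrices ((IsCMField.complexConj L : L ≃ₐ[Fp L] L) : L →+* L) ((gramR L e dV hdV dW hdW).map (algebraMap (Fp L) L)) → {w : InfinitePlace L // w.IsComplex} → Matrix (Fin 2 ⊕ Fin 2) (Fin 2 ⊕ Fin 2) ℂ) (hFrx : ∀ X w, Frx X w = Matrix.J (Fin 2) ℂ)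
    (nfr : {w : InfinitePlace L // w.IsComplex} → (Fin 2 → Fin 2 → ℝ) → Matrix (Fin 2 ⊕ Fin 2) (Fin 2 ⊕ Fin 2) ℂ) (hnfr : ∀ w r, nfr w r = fromBlocks 1 (hermOfReal r) 0 1)
    (blk : Matrix (Fin 2 ⊕ Fin 2) (Fin 2 ⊕ Fin 2) ℂ → Matrix (Fin 2) (Fin 2) ℂ) (hblk : ∀ m, blk m = m.toBlocks₁₂)
    -- (α)'s per-place corner size, sign letter and coordinate frame, BY VALUE
    (tw : skewMatrices ((IsCMField.complexConj L : L ≃ₐ[Fp L] L) : L →+* L) ((gramR L e dV hdV dW hdW).map (algebraMap (Fp L) L)) → InfinitePlace L → ℝ)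
    (htw_eq : ∀ X : skewMatrices ((IsCMField.complexConj L : L ≃ₐ[Fp L] L) : L →+* L) ((gramR L e dV hdV dW hdW).map (algebraMap (Fp L) L)),
      (X : Matrix (Fin 2) (Fin 2) L) ≠ 0 → (X : Matrix (Fin 2) (Fin 2) L).det = 0 → ∀ w' ∈ Tinf, tw X w' = w' (σc X))
    (sgn : skewMatrices ((IsCMField.complexConj L : L ≃ₐ[Fp L] L) : L →+* L) ((gramR L e dV hdV dW hdW).map (algebraMap (Fp L) L)) → InfinitePlace L → Bool)
    (hsgnp : ∀ (X : skewMatrices ((IsCMField.complexConj L : L ≃ₐ[Fp L] L) : L →+* L) ((gramR L e dV hdV dW hdW).map (algebraMap (Fp L) L))) (w : InfinitePlace L),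
      sgn X w = true → 0 < -((t ⟨w, IsTotallyComplex.isComplex w⟩ 1 / |t ⟨w, IsTotallyComplex.isComplex w⟩ 1|) * (w.embedding (σc X)).im))
    (hsgnn : ∀ (X : skewMatrices ((IsCMField.complexConj L : L ≃ₐ[Fp L] L) : L →+* L) ((gramR L e dV hdV dW hdW).map (algebraMap (Fp L) L))) (w : InfinitePlace L),
      sgn X w = false → ¬ 0 < -((t ⟨w, IsTotallyComplex.isComplex w⟩ 1 / |t ⟨w, IsTotallyComplex.isComplex w⟩ 1|) * (w.embedding (σc X)).im))
    (a : Matrix (Fin 2) (Fin 2) ℂ) (hay : ∀ y : ℝ, a * hermTwo (y, 0, 0) * aᴴ = Matrix.single 1 1 (y : ℂ)) :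
    (∀ X : skewMatrices ((IsCMField.complexConj L : L ≃ₐ[Fp L] L) : L →+* L) ((gramR L e dV hdV dW hdW).map (algebraMap (Fp L) L)),
      (X : Matrix (Fin 2) (Fin 2) L) ≠ 0 → (X : Matrix (Fin 2) (Fin 2) L).det = 0 → ∀ (p : φ), ∀ w ∈ Tinf, sgn X w = true →
      ∀ (s : ℂ) (g : Matrix (Fin 2 ⊕ Fin 2) (Fin 2 ⊕ Fin 2) ℂ), gᴴ * Matrix.J (Fin 2) ℂ * g = Matrix.J (Fin 2) ℂ → ∀ r : Fin 2 → Fin 2 → ℝ,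
        (if (⟨w, IsTotallyComplex.isComplex w⟩ : {w : InfinitePlace L // w.IsComplex}) = w₀ then γ X p s else 1) * eb X ⟨w, IsTotallyComplex.isComplex w⟩ (blk (nfr ⟨w, IsTotallyComplex.isComplex w⟩ r)) * Fs X p ⟨w, IsTotallyComplex.isComplex w⟩ s (Frx X ⟨w, IsTotallyComplex.isComplex w⟩ * nfr ⟨w, IsTotallyComplex.isComplex w⟩ r * g) =
          sc X p w s * (cexp (-(2 * Real.pi * Complex.I) * ((a * hermTwo (tw X w, 0, 0) * aᴴ) * hermOfReal r).trace) *
            archScalarSection (k p ⟨w, IsTotallyComplex.isComplex w⟩) s (Matrix.J (Fin 2) ℂ * fromBlocks 1 (hermOfReal r) 0 1 * g))) ∧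
    (∀ X : skewMatrices ((IsCMField.complexConj L : L ≃ₐ[Fp L] L) : L →+* L) ((gramR L e dV hdV dW hdW).map (algebraMap (Fp L) L)),
      (X : Matrix (Fin 2) (Fin 2) L) ≠ 0 → (X : Matrix (Fin 2) (Fin 2) L).det = 0 → ∀ (p : φ), ∀ w ∈ Tinf, sgn X w = false →
      ∀ (s : ℂ) (g : Matrix (Fin 2 ⊕ Fin 2) (Fin 2 ⊕ Fin 2) ℂ), gᴴ * Matrix.J (Fin 2) ℂ * g = Matrix.J (Fin 2) ℂ → ∀ r : Fin 2 → Fin 2 → ℝ,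
        (if (⟨w, IsTotallyComplex.isComplex w⟩ : {w : InfinitePlace L // w.IsComplex}) = w₀ then γ X p s else 1) * eb X ⟨w, IsTotallyComplex.isComplex w⟩ (blk (nfr ⟨w, IsTotallyComplex.isComplex w⟩ r)) * Fs X p ⟨w, IsTotallyComplex.isComplex w⟩ s (Frx X ⟨w, IsTotallyComplex.isComplex w⟩ * nfr ⟨w, IsTotallyComplex.isComplex w⟩ r * g) =
          sc X p w s * (cexp (-(2 * Real.pi * Complex.I) * ((-(a * hermTwo (tw X w, 0, 0) * aᴴ)) * hermOfReal r).trace) *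
            archScalarSection (k p ⟨w, IsTotallyComplex.isComplex w⟩) s (Matrix.J (Fin 2) ℂ * fromBlocks 1 (hermOfReal r) 0 1 * g))) := by
  refine ⟨fun X hX hdet p w hw hsg s g hg r => ?_, fun X hX hdet p w hw hsg s g hg r => ?_⟩
  · have hidxp : (-2 : ℂ) • ((T ⟨w, IsTotallyComplex.isComplex w⟩).toBlocks₂₂ * (Matrix.single (1 : Fin 2) (1 : Fin 2) (σc X)).map (⟨w, IsTotallyComplex.isComplex w⟩ : {w : InfinitePlace L // w.IsComplex}).1.embedding *
        (Tinv ⟨w, IsTotallyComplex.isComplex w⟩).toBlocks₁₁) = a * hermTwo (tw X w, 0, 0) * aᴴ := by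
      rw [htw_eq X hX hdet w hw]
      exact framedCornerIndex_eq_of_pos ⟨w, IsTotallyComplex.isComplex w⟩ _ _ _ (ht _) (hTdef _) (hTinvdef _) a hay (hσskew X hX hdet) (hsgnp X w hsg)
    have hFs' := hFs X p (⟨w, IsTotallyComplex.isComplex w⟩ : {w : InfinitePlace L // w.IsComplex}) s _ (K2LiuHermitianTubeCocycle.mul_mem_UJ (K2LiuArchInducedTubeDefs.J_mul_transl_hermOfReal_mem r) hg)
    simp only [hsc, hblk, hnfr, Matrix.toBlocks_fromBlocks₁₂, hFrx, hFs', heb, hidxp]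
    ring
  · -- `σc X ≠ 0` is skew, so the sign quantity is `≠ 0`: not positive means negative (★ p864832 §3's dichotomy)
    obtain ⟨_, -, hx⟩ := exists_cornerDatum_at_place ⟨w, IsTotallyComplex.isComplex w⟩ _ _ _ (ht _) (hTdef _) (hTinvdef _) 1
    have hneg : -((t ⟨w, IsTotallyComplex.isComplex w⟩ 1 / |t ⟨w, IsTotallyComplex.isComplex w⟩ 1|) * (w.embedding (σc X)).im) < 0 :=
      ((hx (σc X) (hσskew X hX hdet)).2.2 (hσ0 X hX hdet)).resolve_left (hsgnn X w hsg)
    have hidxn : (-2 : ℂ) • ((T ⟨w, IsTotallyComplex.isComplex w⟩).toBlocks₂₂ * (Matrix.single (1 : Fin 2) (1 : Fin 2) (σc X)).map (⟨w, IsTotallyComplex.isComplex w⟩ : {w : InfinitePlace L // w.IsComplex}).1.embedding *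
        (Tinv ⟨w, IsTotallyComplex.isComplex w⟩).toBlocks₁₁) = -(a * hermTwo (tw X w, 0, 0) * aᴴ) := by
      rw [htw_eq X hX hdet w hw]
      exact framedCornerIndex_eq_of_neg ⟨w, IsTotallyComplex.isComplex w⟩ _ _ _ (ht _) (hTdef _) (hTinvdef _) a hay (hσskew X hX hdet) hneg
    have hFs' := hFs X p (⟨w, IsTotallyComplex.isComplex w⟩ : {w : InfinitePlace L // w.IsComplex}) s _ (K2LiuHermitianTubeCocycle.mul_mem_UJ (K2LiuArchInducedTubeDefs.J_mul_transl_hermOfReal_mem r) hg)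
    simp only [hsc, hblk, hnfr, Matrix.toBlocks_fromBlocks₁₂, hFrx, hFs', heb, hidxn]
    ring

/-- **★ p864726's `hA₀` FROM (α) ED.3's `g`-LEVEL AGREEMENTS `hA₀p' hA₀n'`.**  With the letters of `theta_eq_of_record` and the two sign-split `g`-level agreements of
`archLetters_of_scalarTypeGrowth_g` (C2) — `sc X p w s * ∫ r, e(−tr(±a·hermTwo(tw,0,0)·aᴴ·H(r)))·archScalarSection (k p w) s (J·n(r)·g) dr = Ac₀ X p w s g` on `{1/2 < re s}` for `J`-unitary `g` —
the record's local integral agrees with `Ac₀`: ★ `K2LiuIncoherentRankOneBlockDArchOfRecord.blockD_arch_of_record`'s hypothesis `hA₀` :121–:128 VERBATIM (faces `I` generic: at the tie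
`I X h := (I₀ X h).sigma (R X)`, `Rc := Fin 2 → Fin 2 → ℝ`, `B := M₂(ℂ)`). [cite: Shimura1997, §18.4] [cite: Tate1967, §3 Thm. 3.3.1] -/
theorem hA₀_of_hA₀' {φ : Type*} [DecidableEq {w : InfinitePlace L // w.IsComplex}]
    (I : skewMatrices ((IsCMField.complexConj L : L ≃ₐ[Fp L] L) : L →+* L) ((gramR L e dV hdV dW hdW).map (algebraMap (Fp L) L)) → HA L e dV hdV dW hdW → Finset φ) (Tinf : Finset (InfinitePlace L))
    (t : {w : InfinitePlace L // w.IsComplex} → Fin 2 → ℝ) (ht : ∀ w i, t w i ≠ 0) (T Tinv : {w : InfinitePlace L // w.IsComplex} → Matrix (Fin 2 ⊕ Fin 2) (Fin 2 ⊕ Fin 2) ℂ)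
    (hTdef : ∀ w, T w = fromBlocks (diagonal (fun i => (Real.sqrt (|t w i| / 2) : ℂ))) (diagonal (fun i => (Real.sqrt (|t w i| / 2) : ℂ)))
          (diagonal (fun i => Complex.I * (((t w i / |t w i|) * Real.sqrt (|t w i| / 2) : ℝ) : ℂ)))
          (-diagonal (fun i => Complex.I * (((t w i / |t w i|) * Real.sqrt (|t w i| / 2) : ℝ) : ℂ))))
    (hTinvdef : ∀ w, Tinv w = fromBlocks (diagonal (fun i => (((Real.sqrt (|t w i| / 2))⁻¹ / 2 : ℝ) : ℂ)))
          (-diagonal (fun i => Complex.I * (((Real.sqrt (|t w i| / 2))⁻¹ * (t w i / |t w i|) / 2 : ℝ) : ℂ)))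
          (diagonal (fun i => (((Real.sqrt (|t w i| / 2))⁻¹ / 2 : ℝ) : ℂ))) (diagonal (fun i => Complex.I * (((Real.sqrt (|t w i| / 2))⁻¹ * (t w i / |t w i|) / 2 : ℝ) : ℂ))))
    (σc : skewMatrices ((IsCMField.complexConj L : L ≃ₐ[Fp L] L) : L →+* L) ((gramR L e dV hdV dW hdW).map (algebraMap (Fp L) L)) → L)
    (hσskew : ∀ X : skewMatrices ((IsCMField.complexConj L : L ≃ₐ[Fp L] L) : L →+* L) ((gramR L e dV hdV dW hdW).map (algebraMap (Fp L) L)),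
      (X : Matrix (Fin 2) (Fin 2) L) ≠ 0 → (X : Matrix (Fin 2) (Fin 2) L).det = 0 → IsCMField.complexConj L (σc X) = -σc X)
    (hσ0 : ∀ X : skewMatrices ((IsCMField.complexConj L : L ≃ₐ[Fp L] L) : L →+* L) ((gramR L e dV hdV dW hdW).map (algebraMap (Fp L) L)),
      (X : Matrix (Fin 2) (Fin 2) L) ≠ 0 → (X : Matrix (Fin 2) (Fin 2) L).det = 0 → σc X ≠ 0)
    (eb : skewMatrices ((IsCMField.complexConj L : L ≃ₐ[Fp L] L) : L →+* L) ((gramR L e dV hdV dW hdW).map (algebraMap (Fp L) L)) → {w : InfinitePlace L // w.IsComplex} → Matrix (Fin 2) (Fin 2) ℂ → ℂ)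
    (heb : ∀ (X : skewMatrices ((IsCMField.complexConj L : L ≃ₐ[Fp L] L) : L →+* L) ((gramR L e dV hdV dW hdW).map (algebraMap (Fp L) L))) (w : {w : InfinitePlace L // w.IsComplex}) (b : Matrix (Fin 2) (Fin 2) ℂ), eb X w b =
      cexp (-(2 * Real.pi * Complex.I) * (((-2 : ℂ) • ((T w).toBlocks₂₂ * (Matrix.single (1 : Fin 2) (1 : Fin 2) (σc X)).map w.1.embedding * (Tinv w).toBlocks₁₁)) * b).trace))
    (k : φ → {w : InfinitePlace L // w.IsComplex} → ℤ) (Fs : skewMatrices ((IsCMField.complexConj L : L ≃ₐ[Fp L] L) : L →+* L) ((gramR L e dV hdV dW hdW).map (algebraMap (Fp L) L)) → φ → {w : InfinitePlace L // w.IsComplex} → ℂ → Matrix (Fin 2 ⊕ Fin 2) (Fin 2 ⊕ Fin 2) ℂ → ℂ)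
    (cF : φ → {w : InfinitePlace L // w.IsComplex} → ℂ)
    (hFs : ∀ X p w s (m : Matrix (Fin 2 ⊕ Fin 2) (Fin 2 ⊕ Fin 2) ℂ), mᴴ * Matrix.J (Fin 2) ℂ * m = Matrix.J (Fin 2) ℂ → Fs X p w s m = cF p w * archScalarSection (k p w) s m)
    (w₀ : {w : InfinitePlace L // w.IsComplex}) (γ : skewMatrices ((IsCMField.complexConj L : L ≃ₐ[Fp L] L) : L →+* L) ((gramR L e dV hdV dW hdW).map (algebraMap (Fp L) L)) → φ → ℂ → ℂ) (sc : skewMatrices ((IsCMField.complexConj L : L ≃ₐ[Fp L] L) : L →+* L) ((gramR L e dV hdV dW hdW).map (algebraMap (Fp L) L)) → φ → InfinitePlace L → ℂ → ℂ)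
    (hsc : ∀ X p (w : InfinitePlace L) s, sc X p w s = (if (⟨w, IsTotallyComplex.isComplex w⟩ : {w : InfinitePlace L // w.IsComplex}) = w₀ then γ X p s else 1) * cF p ⟨w, IsTotallyComplex.isComplex w⟩)
    (Frx : skewMatrices ((IsCMField.complexConj L : L ≃ₐ[Fp L] L) : L →+* L) ((gramR L e dV hdV dW hdW).map (algebraMap (Fp L) L)) → {w : InfinitePlace L // w.IsComplex} → Matrix (Fin 2 ⊕ Fin 2) (Fin 2 ⊕ Fin 2) ℂ) (hFrx : ∀ X w, Frx X w = Matrix.J (Fin 2) ℂ)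
    (nfr : {w : InfinitePlace L // w.IsComplex} → (Fin 2 → Fin 2 → ℝ) → Matrix (Fin 2 ⊕ Fin 2) (Fin 2 ⊕ Fin 2) ℂ) (hnfr : ∀ w r, nfr w r = fromBlocks 1 (hermOfReal r) 0 1)
    (blk : Matrix (Fin 2 ⊕ Fin 2) (Fin 2 ⊕ Fin 2) ℂ → Matrix (Fin 2) (Fin 2) ℂ) (hblk : ∀ m, blk m = m.toBlocks₁₂)
    (tw : skewMatrices ((IsCMField.complexConj L : L ≃ₐ[Fp L] L) : L →+* L) ((gramR L e dV hdV dW hdW).map (algebraMap (Fp L) L)) → InfinitePlace L → ℝ)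
    (htw_eq : ∀ X : skewMatrices ((IsCMField.complexConj L : L ≃ₐ[Fp L] L) : L →+* L) ((gramR L e dV hdV dW hdW).map (algebraMap (Fp L) L)),
      (X : Matrix (Fin 2) (Fin 2) L) ≠ 0 → (X : Matrix (Fin 2) (Fin 2) L).det = 0 → ∀ w' ∈ Tinf, tw X w' = w' (σc X))
    (sgn : skewMatrices ((IsCMField.complexConj L : L ≃ₐ[Fp L] L) : L →+* L) ((gramR L e dV hdV dW hdW).map (algebraMap (Fp L) L)) → InfinitePlace L → Bool)
    (hsgnp : ∀ (X : skewMatrices ((IsCMField.complexConj L : L ≃ₐ[Fp L] L) : L →+* L) ((gramR L e dV hdV dW hdW).map (algebraMap (Fp L) L))) (w : InfinitePlace L),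
      sgn X w = true → 0 < -((t ⟨w, IsTotallyComplex.isComplex w⟩ 1 / |t ⟨w, IsTotallyComplex.isComplex w⟩ 1|) * (w.embedding (σc X)).im))
    (hsgnn : ∀ (X : skewMatrices ((IsCMField.complexConj L : L ≃ₐ[Fp L] L) : L →+* L) ((gramR L e dV hdV dW hdW).map (algebraMap (Fp L) L))) (w : InfinitePlace L),
      sgn X w = false → ¬ 0 < -((t ⟨w, IsTotallyComplex.isComplex w⟩ 1 / |t ⟨w, IsTotallyComplex.isComplex w⟩ 1|) * (w.embedding (σc X)).im))
    (a : Matrix (Fin 2) (Fin 2) ℂ) (hay : ∀ y : ℝ, a * hermTwo (y, 0, 0) * aᴴ = Matrix.single 1 1 (y : ℂ))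
    -- (α) ED.3 `_g`'s local continuations with the two sign-split agreements (C2)
    (Ac₀ : skewMatrices ((IsCMField.complexConj L : L ≃ₐ[Fp L] L) : L →+* L) ((gramR L e dV hdV dW hdW).map (algebraMap (Fp L) L)) → φ → InfinitePlace L → ℂ → Matrix (Fin 2 ⊕ Fin 2) (Fin 2 ⊕ Fin 2) ℂ → ℂ)
    (hA₀p' : ∀ X : skewMatrices ((IsCMField.complexConj L : L ≃ₐ[Fp L] L) : L →+* L) ((gramR L e dV hdV dW hdW).map (algebraMap (Fp L) L)),
      (X : Matrix (Fin 2) (Fin 2) L) ≠ 0 → (X : Matrix (Fin 2) (Fin 2) L).det = 0 → ∀ (h : HA L e dV hdV dW hdW), ∀ p ∈ I X h, ∀ w ∈ Tinf, sgn X w = true →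
      ∀ s : ℂ, 1 / 2 < s.re → ∀ g : Matrix (Fin 2 ⊕ Fin 2) (Fin 2 ⊕ Fin 2) ℂ, gᴴ * Matrix.J (Fin 2) ℂ * g = Matrix.J (Fin 2) ℂ →
          sc X p w s * (∫ r : Fin 2 → Fin 2 → ℝ, cexp (-(2 * Real.pi * Complex.I) * ((a * hermTwo (tw X w, 0, 0) * aᴴ) * hermOfReal r).trace) *
            archScalarSection (k p ⟨w, IsTotallyComplex.isComplex w⟩) s (Matrix.J (Fin 2) ℂ * fromBlocks 1 (hermOfReal r) 0 1 * g)) = Ac₀ X p w s g)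
    (hA₀n' : ∀ X : skewMatrices ((IsCMField.complexConj L : L ≃ₐ[Fp L] L) : L →+* L) ((gramR L e dV hdV dW hdW).map (algebraMap (Fp L) L)),
      (X : Matrix (Fin 2) (Fin 2) L) ≠ 0 → (X : Matrix (Fin 2) (Fin 2) L).det = 0 → ∀ (h : HA L e dV hdV dW hdW), ∀ p ∈ I X h, ∀ w ∈ Tinf, sgn X w = false →
      ∀ s : ℂ, 1 / 2 < s.re → ∀ g : Matrix (Fin 2 ⊕ Fin 2) (Fin 2 ⊕ Fin 2) ℂ, gᴴ * Matrix.J (Fin 2) ℂ * g = Matrix.J (Fin 2) ℂ →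
          sc X p w s * (∫ r : Fin 2 → Fin 2 → ℝ, cexp (-(2 * Real.pi * Complex.I) * ((-(a * hermTwo (tw X w, 0, 0) * aᴴ)) * hermOfReal r).trace) *
            archScalarSection (k p ⟨w, IsTotallyComplex.isComplex w⟩) s (Matrix.J (Fin 2) ℂ * fromBlocks 1 (hermOfReal r) 0 1 * g)) = Ac₀ X p w s g) :
    -- ★ p864726 `hA₀` :121–:128 (n = 2, `Rc := Fin 2 → Fin 2 → ℝ`)
    ∀ X : skewMatrices ((IsCMField.complexConj L : L ≃ₐ[Fp L] L) : L →+* L) ((gramR L e dV hdV dW hdW).map (algebraMap (Fp L) L)),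
      (X : Matrix (Fin 2) (Fin 2) L) ≠ 0 → (X : Matrix (Fin 2) (Fin 2) L).det = 0 → ∀ (h : HA L e dV hdV dW hdW), ∀ p ∈ I X h, ∀ w ∈ Tinf,
        ∀ s : ℂ, 1 / 2 < s.re → ∀ g : Matrix (Fin 2 ⊕ Fin 2) (Fin 2 ⊕ Fin 2) ℂ, gᴴ * Matrix.J (Fin 2) ℂ * g = Matrix.J (Fin 2) ℂ →
          (fun X (p : φ) (w : InfinitePlace L) s (g : Matrix (Fin 2 ⊕ Fin 2) (Fin 2 ⊕ Fin 2) ℂ) =>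
              ∫ ρ' : Fin 2 → Fin 2 → ℝ, (if (⟨w, IsTotallyComplex.isComplex w⟩ : {w : InfinitePlace L // w.IsComplex}) = w₀ then γ X p s else 1) *
                eb X ⟨w, IsTotallyComplex.isComplex w⟩ (blk (nfr ⟨w, IsTotallyComplex.isComplex w⟩ ρ')) *
                Fs X p ⟨w, IsTotallyComplex.isComplex w⟩ s (Frx X ⟨w, IsTotallyComplex.isComplex w⟩ * nfr ⟨w, IsTotallyComplex.isComplex w⟩ ρ' * g)) X p w s g =
            Ac₀ X p w s g := by
  obtain ⟨hθp, hθn⟩ := theta_eq_of_record L e dV hdV dW hdW Tinf t ht T Tinv hTdef hTinvdef σc hσskew hσ0 eb heb k Fs cF hFs w₀ γ sc hsc Frx hFrx nfr hnfr blk hblk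
    tw htw_eq sgn hsgnp hsgnn a hay
  intro X hX hdet h p hp w hw s hs g hg
  cases hb : sgn X w
  · rw [← hA₀n' X hX hdet h p hp w hw hb s hs g hg, ← integral_const_mul]
    exact integral_congr_ae (Filter.Eventually.of_forall fun r => hθn X hX hdet p w hw hb s g hg r)
  · rw [← hA₀p' X hX hdet h p hp w hw hb s hs g hg, ← integral_const_mul]
    exact integral_congr_ae (Filter.Eventually.of_forall fun r => hθp X hX hdet p w hw hb s g hg r)

end Bridge

/-! ## §3 The pulled-out scalar of record: holomorphy and a local bound ((α) ED.2∕ED.3's letters `hsc hscb`) -/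

section Scalar

variable (L : Type) [Field L] [NumberField L] [IsCMField L]
variable {N M : ℕ} (e : Fin N × Fin M ≃ Fin 2) (dV : Fin N → L) (hdV : ∀ i, IsCMField.complexConj L (dV i) = dV i)
  (dW : Fin M → L) (hdW : ∀ i, IsCMField.complexConj L (dW i) = dW i)

/-- **`hsc` OF RECORD.**  The tie's scalar `sc X p w' s := ([⟨w'⟩ = w₀] ? γt p s : 1) · cF p ⟨w'⟩` with the X-FREE, ENTIRE face scalar of record `γt p s = c^{2(s−2)}·cj p`
(`c = H_𝒦(g_𝒦⁻¹) > 0`, typ4 v29 :757–:758) and the scalar-type constants `cF` is holomorphic on `{0 < re s}` — (α) `archLetters_of_scalarTypeGrowth_g`'s letter `hsc`.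
[cite: Shimura1997, §16.4] [cite: KudlaRallis1994, §2 (2.10)–(2.12)] -/
theorem hsc_of_record {φ : Type*} [DecidableEq {w : InfinitePlace L // w.IsComplex}] (c : ℝ) (hc : 0 < c) (cj : φ → ℂ) (cF : φ → {w : InfinitePlace L // w.IsComplex} → ℂ) (w₀ : {w : InfinitePlace L // w.IsComplex}) :
    ∀ (X : skewMatrices ((IsCMField.complexConj L : L ≃ₐ[Fp L] L) : L →+* L) ((gramR L e dV hdV dW hdW).map (algebraMap (Fp L) L))) (i : φ) (w' : InfinitePlace L), DifferentiableOn ℂ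
      ((fun (_ : skewMatrices ((IsCMField.complexConj L : L ≃ₐ[Fp L] L) : L →+* L) ((gramR L e dV hdV dW hdW).map (algebraMap (Fp L) L))) (p : φ) (w' : InfinitePlace L) (s : ℂ) =>
        (if (⟨w', IsTotallyComplex.isComplex w'⟩ : {w : InfinitePlace L // w.IsComplex}) = w₀ then ((c : ℝ) : ℂ) ^ (2 * (s - 2)) * cj p else 1) * cF p ⟨w', IsTotallyComplex.isComplex w'⟩) X i w')
      {s : ℂ | 0 < s.re} := by
  intro _ i w'
  have hc0 : ((c : ℝ) : ℂ) ≠ 0 := Complex.ofReal_ne_zero.2 hc.ne'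
  have hpow : Differentiable ℂ (fun s : ℂ => ((c : ℝ) : ℂ) ^ (2 * (s - 2))) := fun s =>
    ((differentiableAt_id.sub_const 2).const_mul (2 : ℂ)).const_cpow (Or.inl hc0)
  by_cases hw : (⟨w', IsTotallyComplex.isComplex w'⟩ : {w : InfinitePlace L // w.IsComplex}) = w₀
  · simp only [if_pos hw]
    exact ((hpow.mul_const (cj i)).mul_const _).differentiableOn
  · simp only [if_neg hw]
    exact (differentiable_const _).differentiableOn

/-- **`hscb` OF RECORD.**  The same scalar is bounded near every `z` with `0 < re z`, uniformly in the rank-one index `X`, the point `h`, the face `i` and the place `w'`: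
on `dist s z < 1` the power `c^{2(s−2)}` has modulus `c^{2(re s−2)} ≤ c^{2(re z−3)} + c^{2(re z−1)}`, and the finitely many constants `cj p`, `cF p w` are summed —
(α) `archLetters_of_scalarTypeGrowth_g`'s letter `hscb`. [cite: Shimura1997, §16.4] [cite: KudlaRallis1994, §2 (2.10)–(2.12)] -/
theorem hscb_of_record {φ : Type*} [Fintype φ] [Fintype {w : InfinitePlace L // w.IsComplex}] [DecidableEq {w : InfinitePlace L // w.IsComplex}]
    (I : skewMatrices ((IsCMField.complexConj L : L ≃ₐ[Fp L] L) : L →+* L) ((gramR L e dV hdV dW hdW).map (algebraMap (Fp L) L)) → HA L e dV hdV dW hdW → Finset φ) (Tinf : Finset (InfinitePlace L))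
    (c : ℝ) (hc : 0 < c) (cj : φ → ℂ) (cF : φ → {w : InfinitePlace L // w.IsComplex} → ℂ) (w₀ : {w : InfinitePlace L // w.IsComplex}) :
    ∀ z : ℂ, 0 < z.re → ∃ (Cs rs : ℝ), 0 ≤ Cs ∧ 0 < rs ∧
      ∀ X : skewMatrices ((IsCMField.complexConj L : L ≃ₐ[Fp L] L) : L →+* L) ((gramR L e dV hdV dW hdW).map (algebraMap (Fp L) L)),
      (X : Matrix (Fin 2) (Fin 2) L) ≠ 0 → (X : Matrix (Fin 2) (Fin 2) L).det = 0 → ∀ (h : HA L e dV hdV dW hdW), ∀ i ∈ I X h, ∀ w' ∈ Tinf,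
      ∀ s : ℂ, dist s z < rs → ‖(fun (_ : skewMatrices ((IsCMField.complexConj L : L ≃ₐ[Fp L] L) : L →+* L) ((gramR L e dV hdV dW hdW).map (algebraMap (Fp L) L))) (p : φ) (w' : InfinitePlace L) (s : ℂ) =>
        (if (⟨w', IsTotallyComplex.isComplex w'⟩ : {w : InfinitePlace L // w.IsComplex}) = w₀ then ((c : ℝ) : ℂ) ^ (2 * (s - 2)) * cj p else 1) * cF p ⟨w', IsTotallyComplex.isComplex w'⟩) X i w' s‖ ≤ Cs := by
  intro z _
  -- the `c`-power on the ball `dist s z < 1`: exponent `2(re s − 2) ∈ (2(re z − 3), 2(re z − 1))`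
  have hBc0 : 0 ≤ c ^ (2 * (z.re - 3)) + c ^ (2 * (z.re - 1)) := add_nonneg (Real.rpow_nonneg hc.le _) (Real.rpow_nonneg hc.le _)
  have hCs0 : 0 ≤ ((c ^ (2 * (z.re - 3)) + c ^ (2 * (z.re - 1))) * ∑ p, ‖cj p‖ + 1) * ∑ p, ∑ w : {w : InfinitePlace L // w.IsComplex}, ‖cF p w‖ :=
    mul_nonneg (add_nonneg (mul_nonneg hBc0 (Finset.sum_nonneg fun _ _ => norm_nonneg _)) zero_le_one)
      (Finset.sum_nonneg fun _ _ => Finset.sum_nonneg fun _ _ => norm_nonneg _)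
  refine ⟨((c ^ (2 * (z.re - 3)) + c ^ (2 * (z.re - 1))) * ∑ p, ‖cj p‖ + 1) * ∑ p, ∑ w : {w : InfinitePlace L // w.IsComplex}, ‖cF p w‖, 1, hCs0, one_pos,
    fun _ _ _ _ i _ w' _ s hs => ?_⟩
  have hcj : ‖cj i‖ ≤ ∑ p, ‖cj p‖ := Finset.single_le_sum (f := fun p => ‖cj p‖) (fun p _ => norm_nonneg _) (Finset.mem_univ i)
  have hcF : ‖cF i ⟨w', IsTotallyComplex.isComplex w'⟩‖ ≤ ∑ p, ∑ w : {w : InfinitePlace L // w.IsComplex}, ‖cF p w‖ :=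
    (Finset.single_le_sum (f := fun w : {w : InfinitePlace L // w.IsComplex} => ‖cF i w‖) (fun w _ => norm_nonneg _) (Finset.mem_univ _)).trans
      (Finset.single_le_sum (f := fun p => ∑ w : {w : InfinitePlace L // w.IsComplex}, ‖cF p w‖) (fun p _ => Finset.sum_nonneg fun w _ => norm_nonneg _) (Finset.mem_univ i))
  have hre : |s.re - z.re| < 1 := by
    rw [← Complex.sub_re]
    exact (Complex.abs_re_le_norm (s - z)).trans_lt (by rwa [← dist_eq_norm])
  have hpow : ‖((c : ℝ) : ℂ) ^ (2 * (s - 2))‖ ≤ c ^ (2 * (z.re - 3)) + c ^ (2 * (z.re - 1)) := by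
    rw [Complex.norm_cpow_eq_rpow_re_of_pos hc]
    have hre2 : (2 * (s - 2) : ℂ).re = 2 * (s.re - 2) := by simp [Complex.mul_re]
    rw [hre2]
    rcases le_total 1 c with hc1 | hc1
    · exact (Real.rpow_le_rpow_of_exponent_le hc1 (by linarith [(abs_lt.1 hre).2])).trans (le_add_of_nonneg_left (Real.rpow_nonneg hc.le _))
    · exact (Real.rpow_le_rpow_of_exponent_ge hc hc1 (by linarith [(abs_lt.1 hre).1])).trans (le_add_of_nonneg_right (Real.rpow_nonneg hc.le _))
  show ‖(if (⟨w', IsTotallyComplex.isComplex w'⟩ : {w : InfinitePlace L // w.IsComplex}) = w₀ then ((c : ℝ) : ℂ) ^ (2 * (s - 2)) * cj i else 1) * cF i ⟨w', IsTotallyComplex.isComplex w'⟩‖ ≤ _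
  rw [norm_mul]
  refine mul_le_mul ?_ hcF (norm_nonneg _) (add_nonneg (mul_nonneg hBc0 (Finset.sum_nonneg fun _ _ => norm_nonneg _)) zero_le_one)
  split_ifs
  · rw [norm_mul]
    exact (mul_le_mul hpow hcj (norm_nonneg _) hBc0).trans (le_add_of_nonneg_right zero_le_one)
  · rw [norm_one]
    exact le_add_of_nonneg_left (mul_nonneg hBc0 (Finset.sum_nonneg fun _ _ => norm_nonneg _))

end Scalar

end Summit.HodgeConjecture.HodgeConjecture.Cruxes.HLiu418.K2LiuKindOneSingularArchLocalReadingOfRecord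

end
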